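import Mathlib

/-!
# Route `FordMaynardSieveConst01651`, target `SieveConst01651` (stmt-Parity-19185), line `sieve_decomposition`:
# helpers towards `stub_typeIIRegion` — the entangling conditions of the main case are MONOTONE in the
# Type-II prime `d`

Ford–Maynard, arXiv:2407.14368v1, proof of Proposition 7.22 (p. 40) at `P = (1/2, 0, ν)`: after expanding
`H(n) = ∑_{u ∣ n₁} ∑_{m ∣ n₂} 𝟙[um ≤ n^{1/2}] μ(u) g(𝐯(m; n))` and using `∑_{u ∣ n₁} μ(u) = 0` (`n₁ > 1`), write
`u = d u'` with `d = P⁺(u)` a prime `< n^ν ≤ x^ν` — a Type-II variable at `θ = 0` — and `n = d e`.  For a FIXED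
long index `z = (e, m, u')` (and fixed face data), each condition linking `d` with `z` is monotone or antitone in
the integer `d ≥ 1`, hence an exact integer threshold (`…MonotoneThresholds.bilin_sep_downset / _upset`):

* `lt_rpow_mul_of_le` — `d < (d e)^ν` (i.e. `d ∣ n₁`: `d < n^ν`) is ANTITONE in `d` (`0 ≤ ν ≤ 1`);
* `rpow_mul_le_of_le` — `(d e)^ν ≤ q` (roughness of a prime `q` of `m`: `m ∣ n₂`) is ANTITONE in `d`;
* `mul_sq_le_iff`, `not_sq_le_of_le` — the cutoff `u m > n^{1/2}`, i.e. `¬ (d u' m)² ≤ d e`, is MONOTONE in `d`;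
* `log_natMul_le_log_natMul` and `lt_mul_log_of_le` / `le_mul_log_of_le` / `lt_mul_log_of_ge` / `le_mul_log_of_ge` —
  a polytope face `Λ < b · log(d e)` / `Λ ≤ b · log(d e)` (`Λ = ∑ aᵢ log pᵢ` over the primes of `m`) is MONOTONE in
  `d` for `b ≥ 0` and ANTITONE for `b ≤ 0`;
* (`P⁺(u') < d` is monotone in `d` trivially.)

Def-free, elementary. Nothing here proves anything about the Parity summit; helpers for the Type-II region stub of
one leaf.
-/

namespace Summit.Parity.GeneralizedHardyLittlewood.FordMaynardSieveConst01651SieveConst01651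

/-- **`d < (d e)^ν` is a down-set in `d`** (`0 ≤ ν ≤ 1`, `d' ≥ 1`): if `d' ≤ d` and `d < (d e)^ν` then
`d' < (d' e)^ν` (as `(d' e)^ν = (d'/d)^ν (d e)^ν ≥ (d'/d) (d e)^ν > d'`).  This is the condition "`d` divides the
`n^ν`-smooth part of `n = d e`". [cite: FordMaynard2024PrimeSieves, proof of Proposition 7.22 (the variable `n₁`)] -/
theorem lt_rpow_mul_of_le {ν : ℝ} (hν0 : 0 ≤ ν) (hν1 : ν ≤ 1) (e : ℕ) {d d' : ℕ} (hd' : 1 ≤ d')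
    (hle : d' ≤ d) (h : (d : ℝ) < ((d * e : ℕ) : ℝ) ^ ν) : (d' : ℝ) < ((d' * e : ℕ) : ℝ) ^ ν := by
  have hd : 1 ≤ d := hd'.trans hle
  have hdpos : (0 : ℝ) < d := by exact_mod_cast hd
  have hd'pos : (0 : ℝ) < d' := by exact_mod_cast hd'
  -- `e ≥ 1`
  have he : 1 ≤ e := by
    by_contra he0
    have he0' : e = 0 := by omega
    subst he0'
    rw [mul_zero, Nat.cast_zero] at h
    rcases eq_or_lt_of_le hν0 with hν | hν
    · rw [← hν, Real.rpow_zero] at h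
      have : (1 : ℝ) ≤ d := by exact_mod_cast hd
      linarith
    · rw [Real.zero_rpow hν.ne'] at h
      linarith
  set r : ℝ := (d' : ℝ) / d with hr
  have hr0 : 0 < r := div_pos hd'pos hdpos
  have hr1 : r ≤ 1 := by
    rw [hr, div_le_one hdpos]; exact_mod_cast hle
  have hde0 : (0 : ℝ) ≤ ((d * e : ℕ) : ℝ) := Nat.cast_nonneg _
  have hsplit : ((d' * e : ℕ) : ℝ) = r * ((d * e : ℕ) : ℝ) := by
    rw [hr]; push_cast; field_simp
  rw [hsplit, Real.mul_rpow hr0.le hde0]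
  have hrν : r ≤ r ^ ν := by
    have := Real.rpow_le_rpow_of_exponent_ge hr0 hr1 hν1
    rwa [Real.rpow_one] at this
  have hpos : 0 < ((d * e : ℕ) : ℝ) ^ ν := lt_of_le_of_lt hdpos.le h
  calc (d' : ℝ) = r * d := by rw [hr]; field_simp
    _ < r * ((d * e : ℕ) : ℝ) ^ ν := mul_lt_mul_of_pos_left h hr0
    _ ≤ r ^ ν * ((d * e : ℕ) : ℝ) ^ ν := mul_le_mul_of_nonneg_right hrν hpos.le

/-- **`(d e)^ν ≤ q` is a down-set in `d`** (`ν ≥ 0`): the roughness condition `n^ν ≤ q` on a prime `q` of the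
rough divisor `m`, `n = d e`. [cite: FordMaynard2024PrimeSieves, proof of Proposition 7.22 (the variable `n₂`)] -/
theorem rpow_mul_le_of_le {ν : ℝ} (hν0 : 0 ≤ ν) (e : ℕ) {q : ℝ} {d d' : ℕ} (hle : d' ≤ d)
    (h : ((d * e : ℕ) : ℝ) ^ ν ≤ q) : ((d' * e : ℕ) : ℝ) ^ ν ≤ q := by
  refine le_trans (Real.rpow_le_rpow (Nat.cast_nonneg _) ?_ hν0) h
  exact_mod_cast Nat.mul_le_mul_right e hle

/-- `(d t)² ≤ d e ↔ d t² ≤ e` for `d ≥ 1` (the cutoff `u m ≤ n^{1/2}` with `u = d u'`, `n = d e`, `t = u' m`, after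
`…HwtBound.natCast_le_rpow_half_iff`). [folklore] -/
theorem mul_sq_le_iff {d : ℕ} (hd : 0 < d) (t e : ℕ) : d * t * (d * t) ≤ d * e ↔ d * (t * t) ≤ e := by
  rw [show d * t * (d * t) = d * (d * (t * t)) by ring]
  exact Nat.mul_le_mul_left_iff hd

/-- **The cutoff `u m > n^{1/2}` is an up-set in `d`**: if `d ≤ d'` (`d ≥ 1`) and `¬ (d t)² ≤ d e` then
`¬ (d' t)² ≤ d' e`. [cite: FordMaynard2024PrimeSieves, proof of Proposition 7.22 (the constraint `u ∏ pⱼ ≤ n^γ`)] -/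
theorem not_sq_le_of_le (t e : ℕ) {d d' : ℕ} (hd : 1 ≤ d) (hle : d ≤ d')
    (h : ¬ d * t * (d * t) ≤ d * e) : ¬ d' * t * (d' * t) ≤ d' * e := by
  have hd' : 0 < d' := by omega
  rw [mul_sq_le_iff (by omega)] at h
  rw [mul_sq_le_iff hd']
  intro h'
  exact h ((Nat.mul_le_mul_right (t * t) hle).trans h')

/-- `log(d e) ≤ log(d' e)` for `1 ≤ d ≤ d'` (natural numbers; `e = 0` gives `log 0 = log 0`). [folklore] -/
theorem log_natMul_le_log_natMul (e : ℕ) {d d' : ℕ} (hd : 1 ≤ d) (hle : d ≤ d') :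
    Real.log ((d * e : ℕ) : ℝ) ≤ Real.log ((d' * e : ℕ) : ℝ) := by
  rcases Nat.eq_zero_or_pos e with he | he
  · subst he; simp
  · apply Real.log_le_log
    · have : 0 < d * e := Nat.mul_pos (by omega) he
      exact_mod_cast this
    · exact_mod_cast Nat.mul_le_mul_right e hle

/-- **A face `Λ < b log n` with `b ≥ 0` is an up-set in `d`** (`n = d e`; `Λ = ∑ aᵢ log pᵢ` over the primes of the
rough divisor `m` — "the conditions `𝐯(p₁⋯p_k; n) ∈ 𝒯` … are all systems of linear inequalities").
[cite: FordMaynard2024PrimeSieves, proof of Proposition 7.22 (polytope conditions)] -/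
theorem lt_mul_log_of_le {Λ b : ℝ} (hb : 0 ≤ b) (e : ℕ) {d d' : ℕ} (hd : 1 ≤ d) (hle : d ≤ d')
    (h : Λ < b * Real.log ((d * e : ℕ) : ℝ)) : Λ < b * Real.log ((d' * e : ℕ) : ℝ) :=
  lt_of_lt_of_le h (mul_le_mul_of_nonneg_left (log_natMul_le_log_natMul e hd hle) hb)

/-- A non-strict face `Λ ≤ b log n` with `b ≥ 0` is an up-set in `d`.
[cite: FordMaynard2024PrimeSieves, proof of Proposition 7.22 (polytope conditions)] -/
theorem le_mul_log_of_le {Λ b : ℝ} (hb : 0 ≤ b) (e : ℕ) {d d' : ℕ} (hd : 1 ≤ d) (hle : d ≤ d')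
    (h : Λ ≤ b * Real.log ((d * e : ℕ) : ℝ)) : Λ ≤ b * Real.log ((d' * e : ℕ) : ℝ) :=
  le_trans h (mul_le_mul_of_nonneg_left (log_natMul_le_log_natMul e hd hle) hb)

/-- **A face `Λ < b log n` with `b ≤ 0` is a down-set in `d`** (`d' ≤ d`, `d' ≥ 1`).
[cite: FordMaynard2024PrimeSieves, proof of Proposition 7.22 (polytope conditions)] -/
theorem lt_mul_log_of_ge {Λ b : ℝ} (hb : b ≤ 0) (e : ℕ) {d d' : ℕ} (hd' : 1 ≤ d') (hle : d' ≤ d)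
    (h : Λ < b * Real.log ((d * e : ℕ) : ℝ)) : Λ < b * Real.log ((d' * e : ℕ) : ℝ) :=
  lt_of_lt_of_le h (mul_le_mul_of_nonpos_left (log_natMul_le_log_natMul e hd' hle) hb)

/-- A non-strict face `Λ ≤ b log n` with `b ≤ 0` is a down-set in `d`.
[cite: FordMaynard2024PrimeSieves, proof of Proposition 7.22 (polytope conditions)] -/
theorem le_mul_log_of_ge {Λ b : ℝ} (hb : b ≤ 0) (e : ℕ) {d d' : ℕ} (hd' : 1 ≤ d') (hle : d' ≤ d)
    (h : Λ ≤ b * Real.log ((d * e : ℕ) : ℝ)) : Λ ≤ b * Real.log ((d' * e : ℕ) : ℝ) :=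
  le_trans h (mul_le_mul_of_nonpos_left (log_natMul_le_log_natMul e hd' hle) hb)

/-- For `n ≥ 1` (real `L = log n ≥ 0`… here any `L > 0`): a face in the normalised coordinates
`∑ aᵢ (yᵢ / L) < b` is the condition `∑ aᵢ yᵢ < b L`; likewise for `≤`. (Pointwise form of
`…PolytopeConditions.mem_setOf_faces_div_iff`.) [cite: FordMaynard2024PrimeSieves, proof of Proposition 7.22 (polytope conditions)] -/
theorem sum_mul_div_lt_iff {k : ℕ} (a y : Fin k → ℝ) {L b : ℝ} (hL : 0 < L) :
    (∑ i, a i * (y i / L) < b) ↔ (∑ i, a i * y i < b * L) := by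
  have : ∑ i, a i * (y i / L) = (∑ i, a i * y i) / L := by
    rw [Finset.sum_div]; exact Finset.sum_congr rfl fun i _ => by ring
  rw [this, div_lt_iff₀ hL]

/-- Non-strict version of `sum_mul_div_lt_iff`. [cite: FordMaynard2024PrimeSieves, proof of Proposition 7.22 (polytope conditions)] -/
theorem sum_mul_div_le_iff {k : ℕ} (a y : Fin k → ℝ) {L b : ℝ} (hL : 0 < L) :
    (∑ i, a i * (y i / L) ≤ b) ↔ (∑ i, a i * y i ≤ b * L) := by
  have : ∑ i, a i * (y i / L) = (∑ i, a i * y i) / L := by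
    rw [Finset.sum_div]; exact Finset.sum_congr rfl fun i _ => by ring
  rw [this, div_le_iff₀ hL]

end Summit.Parity.GeneralizedHardyLittlewood.FordMaynardSieveConst01651SieveConst01651
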